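import Summits.HodgeConjecture.HodgeConjecture.Theorems.Ring2AbelianAllAndreFibreClassKernelOfDeligne
import Summits.HodgeConjecture.HodgeConjecture.Theorems.Ring2AbelianAllAndreTransportLatticeCM
import Literature.AlgebraicGeometry.HodgeTheory.HodgeRiemannPolarizabilityProofs
import Literature.AlgebraicGeometry.HodgeTheory.MotivatedClassesHodgeClassesHolds
import Literature.AlgebraicGeometry.HodgeTheory.HodgeIndexPrimitiveAlgebraicProofs
import HarnessLib

/-!
# Ring 2 · sub-cell AbelianAll (ALL ABELIAN VARIETIES), André axis, part XVIII-b — "HOM ≡ NUM" FOR HODGE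
# CLASSES: on a smooth projective variety the cup pairing `Hdg^p ⊗ ℂ × Hdg^q ⊗ ℂ → H^{2n}` (`p + q = n`) is
# NON-DEGENERATE ON BOTH SIDES; hence at a fibre satisfying the Hodge conjecture (e.g. a CM fibre under
# `HC_CM`) the fibre hypothesis (Perf) of part XVIII-a is automatic

HONEST FRAMING (page 1, verbatim): **research route, not a corollary; conditional on HC_CM plus one named
minimal statement.** Cell line: research route conditional on HC_CM; not a corollary; Q11.4-sentence-2
already refuted in dim ≥ 3. Nothing in this file proves a case of the Hodge conjecture for an abelian variety.
`HC_CM` = `Theses.RankFourFaces.CMAbelianHodge` is a BINDER wherever it occurs. Seat `pub-hodge-ring2-ab-andre-2`,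
gen 10 (sequel of part XVIII-a).

## The argument (the classical "`HC(X) ⇒ D(X)`", Kleiman 1968 §3 / Lieberman 1968, on the real carriers)

Let `Q = Q_D` be the polarisation form of a Kähler–rational datum `D` of `X` on `H^{2p}(X(ℂ); ℂ)` (the tree's
`KaehlerRationalDatum.cform`: `Q(x, y) = Σ_P ± τ(L^{n-a} ξ_P x ∪ ξ_P y)` over the Lefschetz indices `P = (a, t)`).
§1 (any coefficient ring): by the cup-product bridge of part XII-a, `Q(x, ·) = τ(z ∪ ·)` for the class
`z = Σ_P ± L^{n-a-t} ξ_P x ∈ H^{2q}`, which lies in any submodule containing the Lefschetz terms of `x`.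
§2: if `x` is a RATIONAL class of type `(p,p)` then each term `L^{n-a-t} ξ_P x` is rational (primitive parts of
rational classes are rational, `ringChange_primitivePart_of_eq`; `η` rational) and of type `(q,q)` (primitive parts
have pure type, `L` raises types by `(1,1)`), so `z ∈ T_q := span_ℂ Hdg^q`; by linearity the same for every
`x ∈ T_p := span_ℂ Hdg^p`. §3: if `ξ ∈ T_p` is cup-orthogonal to `T_q`, apply this to `x = conj ξ ∈ T_p`:
`Q(x, conj x) = τ(z ∪ ξ) = 0` with `z ∈ T_q`, so `x = 0` by the second Hodge–Riemann relation for classes of pure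
type `(p,p)` (the tree's `KaehlerRationalDatum.cform_conj_pos`), i.e. `ξ = 0`. Symmetrically on the right. Under
`HC` for `X` in degrees `2p` and `2q`, `N^p = T_p` and `N^q = T_q`, which is (Perf) of part XVIII-a; at a CM fibre
this is supplied by `HC_CM` (binder).

## What is proved (theorems only; no definition, no named fact, no sorry)

§1 `exists_polarizationForm_eq_trace_cupProduct` (generic). §2 `conjClass_mem_span_hodge`,
`lefschetzPowTo_primitivePart_mem_span_hodge`. §3 **`eq_zero_of_forall_cupProduct_span_hodge_eq_zero`** (left) and
**`…'`** (right): non-degeneracy of the cup pairing on `T_p × T_q`; **`nondegenerate_algebraicClasses_of_hodge`**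
(`HC^p(X) ∧ HC^q(X) ⟹` (Perf) for `N^p(X) × N^q(X)`); **`nondegenerate_algebraicClasses_fiberOver_of_HC_CM`**
(at CM fibres of compact pencils, `HC_CM` a binder).

References: Kleiman1968AlgebraicCycles (§3); Lieberman1968; VoisinHodgeI2002 (§6.2.3 Cor. 6.26, Lemma 6.29, §6.3.2
Thm. 6.32, §7.1.2); HatcherAT2002 (§3.2 Thm. 3.11, §3.3 Prop. 3.38); Andre1996Motifs (§6.3).
-/

noncomputable section

set_option linter.dupNamespace false

namespace Summit.HodgeConjecture.HodgeConjecture.Ring2.AbelianAll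

open CategoryTheory AlgebraicGeometry
open Literature.AlgebraicGeometry Literature.AlgebraicGeometry.Motives
open Literature.AlgebraicGeometry.HodgeTheory
open Literature.AlgebraicTopology.SingularHomology (singularCohomology cupProduct cupProduct_gradedComm_holds)
open Literature.Geometry.Kaehler (lefschetzOperator HasHardLefschetzProperty)
open Literature.AlgebraicGeometry.Deligne1982 (cmLocus)
open Summit.HodgeConjecture.HodgeConjecture.Theses

/-! ## §1 The polarisation form is a cup product: `Q(x, ·) = τ(z ∪ ·)` -/

section Generic

universe u v

variable {Y : Type u} [TopologicalSpace Y] {R : Type v} [CommRing R] {κ : singularCohomology R R Y 2} {n : ℕ}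

/-- **The polarisation form of the Lefschetz decomposition is a cup product**: for `x ∈ Hⁱ(Y; R)` and
`m + i = 2n` there is `z ∈ Hᵐ(Y; R)` with `Q(x, y) = τ(z ∪ y)` for all `y` — namely
`z = Σ_{P=(a,t), a+t ≤ n} (-1)^{a(a-1)/2} L^{n-a-t} ξ_P x` (cup-product bridge `L^{n-a} u ∪ ξ_P y = L^{n-a-t} u ∪ y`
for `u` primitive, part XII-a) — and `z` lies in every submodule `M` containing these Lefschetz terms of `x`.
[cite: VoisinHodgeI2002, §6.2.3 Lemma 6.29 and §6.3.2 Thm. 6.32] [cite: HatcherAT2002, §3.2 Thm. 3.11] -/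
theorem exists_polarizationForm_eq_trace_cupProduct (hL : HasHardLefschetzProperty κ n)
    (hvan : ∀ m, 2 * n < m → Subsingleton (singularCohomology R R Y m))
    (τ : singularCohomology R R Y (2 * n) →ₗ[R] R) {i m : ℕ} (hmi : m + i = 2 * n)
    (x : singularCohomology R R Y i) (M : Submodule R (singularCohomology R R Y m))
    (hM : ∀ (P : {p : ℕ × ℕ // p.1 + 2 * p.2 = i}) (s' : ℕ) (hs' : P.1.1 + P.1.2 + s' = n)
      (hq : P.1.1 + 2 * s' = m), lefschetzPowTo κ s' P.1.1 m hq (primitivePart κ n hL hvan P x) ∈ M) :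
    ∃ z ∈ M, ∀ y : singularCohomology R R Y i,
      polarizationForm κ n hL hvan τ i x y = τ (cupProduct hmi z y) := by
  classical
  -- the candidate `z`
  let zP : {p : ℕ × ℕ // p.1 + 2 * p.2 = i} → singularCohomology R R Y m := fun P ↦
    if hP : P.1.1 + P.1.2 ≤ n then
      ((-1 : R) ^ (P.1.1 * (P.1.1 - 1) / 2)) •
        lefschetzPowTo κ (n - P.1.1 - P.1.2) P.1.1 m (by have := P.2; omega) (primitivePart κ n hL hvan P x)
    else 0
  refine ⟨∑ P, zP P, Submodule.sum_mem _ fun P _ ↦ ?_, fun y ↦ ?_⟩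
  · by_cases hP : P.1.1 + P.1.2 ≤ n
    · simp only [zP, dif_pos hP]
      exact Submodule.smul_mem _ _ (hM P (n - P.1.1 - P.1.2) (by omega) (by have := P.2; omega))
    · simp only [zP, dif_neg hP]
      exact Submodule.zero_mem _
  · rw [polarizationForm_apply, map_sum, LinearMap.sum_apply, map_sum]
    refine Finset.sum_congr rfl fun P _ ↦ ?_
    have hP2 := P.2
    by_cases hP : P.1.1 + P.1.2 ≤ n
    · obtain ⟨s, hs⟩ : ∃ s, P.1.1 + s = n := ⟨n - P.1.1, by omega⟩
      rw [hodgeRiemannPairing_apply τ hs rfl (by omega : (P.1.1 + 2 * s) + P.1.1 = 2 * n),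
        cupProduct_lefschetzPowTo_primitivePart_eq κ hL hvan P (primitivePart_mem hL hvan P x) y hs rfl
          (by omega) (show P.1.1 + P.1.2 + (n - P.1.1 - P.1.2) = n by omega)
          (show P.1.1 + 2 * (n - P.1.1 - P.1.2) = m by omega) hmi]
      simp only [zP, dif_pos hP, map_smul, LinearMap.smul_apply, smul_eq_mul]
    · have hlt : n < P.1.1 + P.1.2 := not_le.1 hP
      simp only [zP, dif_neg hP, map_zero, LinearMap.zero_apply, primitivePart_of_lt hL hvan P hlt]

end Generic

/-! ## §2 On `X(ℂ)`: the Lefschetz terms of a class in `span_ℂ Hdg^p` lie in `span_ℂ Hdg^q` -/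

section Span

variable {n : ℕ} {X : SchemeOver ℂ}

/-- `span_ℂ Hdg^p` is stable under complex conjugation (rational classes are real, Voisin I Cor. 6.12, and
conjugation is conjugate-linear). [cite: VoisinHodgeI2002, Cor. 6.12] -/
theorem conjClass_mem_span_hodge (p : ℕ) {c : complexBetti X (2 * p)}
    (hc : c ∈ Submodule.span ℂ {c : complexBetti X (2 * p) | IsRationalClass c ∧ IsOfHodgeType n X (2 * p) p p c}) :
    conjClass (ComplexPoints X) (2 * p) c ∈
      Submodule.span ℂ {c : complexBetti X (2 * p) | IsRationalClass c ∧ IsOfHodgeType n X (2 * p) p p c} := by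
  induction hc using Submodule.span_induction with
  | mem c hc =>
    rw [hc.1.conjClass_eq]
    exact Submodule.subset_span hc
  | zero => rw [conjClass_zero]; exact Submodule.zero_mem _
  | add c c' _ _ hc hc' => rw [conjClass_add]; exact Submodule.add_mem _ hc hc'
  | smul a c _ hc => rw [conjClass_smul]; exact Submodule.smul_mem _ _ hc

/-- **The Lefschetz terms `L^{s'} ξ_P x` (`P = (a,t)`, `a + t + s' = n`) of a class `x ∈ span_ℂ Hdg^p(X)` lie in
`span_ℂ Hdg^q(X)`**, `p + q = n`, for the Lefschetz operator of a Kähler–rational datum `D`: for a rational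
`(p,p)`-class `x`, `ξ_P x` is rational (`ringChange_primitivePart_of_eq`) of type `(p-t, p-t)`
(`primitivePart_mem_typePiece`), and `L^{s'}` keeps rationality (`η` rational) and raises the type to `(q,q)`.
[cite: VoisinHodgeI2002, §6.2.3 Cor. 6.26, Rem. 6.27 and §7.1.2] -/
theorem lefschetzPowTo_primitivePart_mem_span_hodge (hX : IsSmoothProjective n X) (D : KaehlerRationalDatum n X)
    {p q : ℕ} (hpq : p + q = n) {x : complexBetti X (2 * p)}
    (hx : x ∈ Submodule.span ℂ {c : complexBetti X (2 * p) | IsRationalClass c ∧ IsOfHodgeType n X (2 * p) p p c})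
    (P : {P : ℕ × ℕ // P.1 + 2 * P.2 = 2 * p}) (s' : ℕ) (hs' : P.1.1 + P.1.2 + s' = n)
    (hq : P.1.1 + 2 * s' = 2 * q) :
    lefschetzPowTo D.Hη s' P.1.1 (2 * q) hq (primitivePart D.Hη n (D.hLℂ hX) (subsingleton_of_lt hX ℂ) P x) ∈
      Submodule.span ℂ {c : complexBetti X (2 * q) | IsRationalClass c ∧ IsOfHodgeType n X (2 * q) q q c} := by
  have hP2 := P.2
  obtain ⟨A⟩ := nonempty_hodgeModel_holds hX
  have hI := hodgePQ_independent_of_hodgeModel_holds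
  induction hx using Submodule.span_induction with
  | zero => rw [map_zero, map_zero]; exact Submodule.zero_mem _
  | add c c' _ _ hc hc' => rw [map_add, map_add]; exact Submodule.add_mem _ hc hc'
  | smul a c _ hc => rw [map_smul, map_smul]; exact Submodule.smul_mem _ _ hc
  | mem c hc =>
    obtain ⟨hcQ, hcH⟩ := hc
    -- rationality of the primitive part
    have hξQ : IsRationalClass (primitivePart D.Hη n (D.hLℂ hX) (subsingleton_of_lt hX ℂ) P c) := by
      obtain ⟨c₀, rfl⟩ := (isRationalClass_iff_mem_range_ofRatClass c).1 hcQ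
      rw [ofRatClass_eq_ringChange, ← ringChange_primitivePart_of_eq (D.hLℚ hX) (subsingleton_of_lt hX ℚ)
        (algebraMap ℚ ℂ) D.ringChange_eq (D.hLℂ hX) (subsingleton_of_lt hX ℂ) P c₀, ← ofRatClass_eq_ringChange]
      exact isRationalClass_ofRatClass _
    -- Hodge type `(p - t, p - t)` of the primitive part
    have hst : (p - P.1.2, p - P.1.2) ∈ Finset.HasAntidiagonal.antidiagonal P.1.1 :=
      Finset.HasAntidiagonal.mem_antidiagonal.2 (by omega)
    have hpp : (p, p) ∈ Finset.HasAntidiagonal.antidiagonal (2 * p) :=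
      Finset.HasAntidiagonal.mem_antidiagonal.2 (by omega)
    have hcA : c ∈ A.typePiece (2 * p) ⟨(p, p), hpp⟩ := A.mem_typePiece_of_isOfHodgeType hI hX hpp hcH
    have hξT := D.primitivePart_mem_typePiece hX A hcA P ⟨(p - P.1.2, p - P.1.2), hst⟩ (by push_cast; ring)
    have hξH := A.isOfHodgeType_of_mem_typePiece hξT
    dsimp only at hξH
    -- `L^{s'}` keeps rationality and raises the type to `(q, q)`
    have hup := isOfHodgeType_lefschetzOperator_of_cupPreservesHodgeType
      (cupPreservesHodgeType_of_hodgeModel hX D.B) D.isOfHodgeType_Hη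
    have hLH := isOfHodgeType_lefschetzPow_of_lefschetzOperator hup s' P.1.1 (p - P.1.2) (p - P.1.2) _ hξH
    have hq' : p - P.1.2 + s' = q := by omega
    rw [hq'] at hLH
    have key : ∀ (m : ℕ) (hm : P.1.1 + 2 * s' = m),
        IsOfHodgeType n X m q q (lefschetzPowTo D.Hη s' P.1.1 m hm
          (primitivePart D.Hη n (D.hLℂ hX) (subsingleton_of_lt hX ℂ) P c)) := by
      intro m hm
      subst hm
      rw [lefschetzPowTo_eq_lefschetzPow]
      exact hLH
    exact Submodule.subset_span ⟨D.isRationalClass_Hη.lefschetzPowTo s' P.1.1 (2 * q) hq hξQ, key (2 * q) hq⟩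

/-- `span_ℂ Hdg^p` lies in the type piece `(p,p)` of every Hodge model. [cite: VoisinHodgeI2002, §7.1.1] -/
theorem span_hodge_le_typePiece (hX : IsSmoothProjective n X) (A : HodgeModel n X) (p : ℕ)
    (hpp : (p, p) ∈ Finset.HasAntidiagonal.antidiagonal (2 * p)) :
    Submodule.span ℂ {c : complexBetti X (2 * p) | IsRationalClass c ∧ IsOfHodgeType n X (2 * p) p p c} ≤
      A.typePiece (2 * p) ⟨(p, p), hpp⟩ :=
  Submodule.span_le.2 fun _ hc ↦ A.mem_typePiece_of_isOfHodgeType hodgePQ_independent_of_hodgeModel_holds hX hpp hc.2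

end Span

/-! ## §3 Non-degeneracy of the cup pairing on `span_ℂ Hdg^p × span_ℂ Hdg^q` -/

section Nondegenerate

variable {n : ℕ} {X : SchemeOver ℂ}

/-- **LEFT NON-DEGENERACY OF THE CUP PAIRING ON HODGE CLASSES.** For `X` smooth projective of dimension `n`,
`p + q = n`, and `ξ ∈ span_ℂ Hdg^p(X)`: if `ξ ∪ h = 0` for every `h ∈ span_ℂ Hdg^q(X)` then `ξ = 0`. Proof:
`Q_D(conj ξ, ξ) = τ(z ∪ ξ)` with `z ∈ span_ℂ Hdg^q` (§1–§2 for `x = conj ξ ∈ span_ℂ Hdg^p`), `= 0`; and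
`Q_D(x, conj x) ≠ 0` for `0 ≠ x` of pure type `(p,p)` (second Hodge–Riemann relation, the tree's `cform_conj_pos`).
This is the Hodge-theoretic "hom ≡ num" (`HC(X) ⇒ D(X)`, Kleiman/Lieberman) in its cohomological core.
[cite: Kleiman1968AlgebraicCycles, §3] [cite: VoisinHodgeI2002, §6.3.2 Thm. 6.32 and §7.1.2] -/
theorem eq_zero_of_forall_cupProduct_span_hodge_eq_zero (hX : IsSmoothProjective n X) {p q : ℕ} (hpq : p + q = n)
    {ξ : complexBetti X (2 * p)}
    (hξ : ξ ∈ Submodule.span ℂ {c : complexBetti X (2 * p) | IsRationalClass c ∧ IsOfHodgeType n X (2 * p) p p c})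
    (h : ∀ h ∈ Submodule.span ℂ {c : complexBetti X (2 * q) | IsRationalClass c ∧ IsOfHodgeType n X (2 * q) q q c},
      cupProduct (show 2 * p + 2 * q = 2 * n by omega) ξ h = 0) :
    ξ = 0 := by
  obtain ⟨D⟩ := nonempty_kaehlerRationalDatum hX
  obtain ⟨A⟩ := nonempty_hodgeModel_holds hX
  have hI := hodgePQ_independent_of_hodgeModel_holds
  set x := conjClass (ComplexPoints X) (2 * p) ξ with hxdef
  have hx : x ∈ Submodule.span ℂ {c : complexBetti X (2 * p) | IsRationalClass c ∧ IsOfHodgeType n X (2 * p) p p c} :=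
    conjClass_mem_span_hodge p hξ
  -- `Q_D(x, ·) = τ(z ∪ ·)` with `z ∈ span Hdg^q`
  obtain ⟨z, hz, hQ⟩ := exists_polarizationForm_eq_trace_cupProduct (D.hLℂ hX) (subsingleton_of_lt hX ℂ)
    (D.cTrace hX) (show 2 * q + 2 * p = 2 * n by omega) x _
    (fun P s' hs' hq ↦ lefschetzPowTo_primitivePart_mem_span_hodge hX D hpq hx P s' hs' hq)
  -- `Q_D(x, conj x) = τ(z ∪ ξ) = ± τ(ξ ∪ z) = 0`
  have h0 : D.cform hX (2 * p) x (conjClass (ComplexPoints X) (2 * p) x) = 0 := by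
    rw [hxdef, conjClass_conjClass ξ, ← hxdef, KaehlerRationalDatum.cform, hQ,
      cupProduct_gradedComm_holds ℂ (ComplexPoints X) (show 2 * q + 2 * p = 2 * n by omega)
        (show 2 * p + 2 * q = 2 * n by omega) z ξ, h z hz, smul_zero, map_zero]
  -- Hodge–Riemann: `x = 0`
  by_contra hξ0
  have hx0 : x ≠ 0 := by
    intro hx0
    apply hξ0
    rw [← conjClass_conjClass ξ, ← hxdef, hx0, conjClass_zero]
  have hpp : (p, p) ∈ Finset.HasAntidiagonal.antidiagonal (2 * p) := Finset.HasAntidiagonal.mem_antidiagonal.2 (by omega)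
  have hxA : x ∈ A.typePiece (2 * p) ⟨(p, p), hpp⟩ := span_hodge_le_typePiece hX A p hpp hx
  obtain ⟨r, hr, hQr⟩ := D.cform_conj_pos hX A hpp hxA hx0
  rw [h0, mul_zero] at hQr
  exact hr.ne' (by exact_mod_cast hQr.symm)

/-- **RIGHT NON-DEGENERACY** (the same with `p`, `q` exchanged and graded commutativity in even degrees).
[cite: Kleiman1968AlgebraicCycles, §3] [cite: VoisinHodgeI2002, §6.3.2 Thm. 6.32 and §7.1.2] -/
theorem eq_zero_of_forall_cupProduct_span_hodge_eq_zero' (hX : IsSmoothProjective n X) {p q : ℕ} (hpq : p + q = n)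
    {h : complexBetti X (2 * q)}
    (hh : h ∈ Submodule.span ℂ {c : complexBetti X (2 * q) | IsRationalClass c ∧ IsOfHodgeType n X (2 * q) q q c})
    (h0 : ∀ ξ ∈ Submodule.span ℂ {c : complexBetti X (2 * p) | IsRationalClass c ∧ IsOfHodgeType n X (2 * p) p p c},
      cupProduct (show 2 * p + 2 * q = 2 * n by omega) ξ h = 0) :
    h = 0 := by
  refine eq_zero_of_forall_cupProduct_span_hodge_eq_zero hX (show q + p = n by omega) hh fun ξ hξ ↦ ?_
  rw [cupProduct_gradedComm_holds ℂ (ComplexPoints X) (show 2 * q + 2 * p = 2 * n by omega)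
    (show 2 * p + 2 * q = 2 * n by omega) h ξ, h0 ξ hξ, smul_zero]

/-- **`HC^p(X) ∧ HC^q(X) ⟹` (Perf) for `N^p(X) × N^q(X)`**: if the rational `(p,p)`- and `(q,q)`-classes of `X` are
algebraic (`p + q = n`) then `N^p = span_ℂ Hdg^p`, `N^q = span_ℂ Hdg^q` (the tree's `algebraicClasses_le_span_hodgeClasses`
for `⊆`) and the cup pairing `N^p(X) × N^q(X) → H^{2n}(X(ℂ); ℂ)` is non-degenerate on both sides.
[cite: Kleiman1968AlgebraicCycles, §3] [cite: Lieberman1968, main theorem] -/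
theorem nondegenerate_algebraicClasses_of_hodge (hX : IsSmoothProjective n X) {p q : ℕ} (hpq : p + q = n)
    (hp : ∀ c : complexBetti X (2 * p), IsRationalClass c → IsOfHodgeType n X (2 * p) p p c → c ∈ algebraicClasses X p)
    (hq : ∀ c : complexBetti X (2 * q), IsRationalClass c → IsOfHodgeType n X (2 * q) q q c → c ∈ algebraicClasses X q) :
    (∀ ξ ∈ algebraicClasses X p,
        (∀ b ∈ algebraicClasses X q, cupProduct (show 2 * p + 2 * q = 2 * n by omega) ξ b = 0) → ξ = 0) ∧
      (∀ b ∈ algebraicClasses X q,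
        (∀ ξ ∈ algebraicClasses X p, cupProduct (show 2 * p + 2 * q = 2 * n by omega) ξ b = 0) → b = 0) := by
  have hNp : algebraicClasses X p =
      Submodule.span ℂ {c : complexBetti X (2 * p) | IsRationalClass c ∧ IsOfHodgeType n X (2 * p) p p c} :=
    le_antisymm (algebraicClasses_le_span_hodgeClasses hX p) (Submodule.span_le.2 fun c hc ↦ hp c hc.1 hc.2)
  have hNq : algebraicClasses X q =
      Submodule.span ℂ {c : complexBetti X (2 * q) | IsRationalClass c ∧ IsOfHodgeType n X (2 * q) q q c} :=
    le_antisymm (algebraicClasses_le_span_hodgeClasses hX q) (Submodule.span_le.2 fun c hc ↦ hq c hc.1 hc.2)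
  refine ⟨fun ξ hξ hb ↦ ?_, fun b hb hξ ↦ ?_⟩
  · rw [hNp] at hξ
    exact eq_zero_of_forall_cupProduct_span_hodge_eq_zero hX hpq hξ fun h hh ↦ hb h (by rw [hNq]; exact hh)
  · rw [hNq] at hb
    exact eq_zero_of_forall_cupProduct_span_hodge_eq_zero' hX hpq hb fun ξ hξ' ↦ hξ ξ (by rw [hNp]; exact hξ')

end Nondegenerate

/-! ## §4 Compact pencils: (Perf) at a fibre satisfying `HC`, and at CM fibres under `HC_CM` -/

variable {𝒳 S : SchemeOver ℂ}

/-- **(Perf_t) at a fibre of a compact pencil satisfying the Hodge conjecture in degrees `2p`, `2q`** (`p + q = d`).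
[cite: Kleiman1968AlgebraicCycles, §3] [cite: Lieberman1968, main theorem] -/
theorem nondegenerate_algebraicClasses_fiberOver_of_hodge {d : ℕ} {f : 𝒳 ⟶ S} (hf : IsCompactAbelianPencil f d)
    (t : ComplexPoints S) {p q : ℕ} (hpq : p + q = d)
    (hp : ∀ c : complexBetti (fiberOver f t) (2 * p), IsRationalClass c →
      IsOfHodgeType d (fiberOver f t) (2 * p) p p c → c ∈ algebraicClasses (fiberOver f t) p)
    (hq : ∀ c : complexBetti (fiberOver f t) (2 * q), IsRationalClass c →
      IsOfHodgeType d (fiberOver f t) (2 * q) q q c → c ∈ algebraicClasses (fiberOver f t) q) :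
    (∀ ξ ∈ algebraicClasses (fiberOver f t) p,
        (∀ b ∈ algebraicClasses (fiberOver f t) q, cupProduct (show 2 * p + 2 * q = 2 * d by omega) ξ b = 0) → ξ = 0) ∧
      (∀ b ∈ algebraicClasses (fiberOver f t) q,
        (∀ ξ ∈ algebraicClasses (fiberOver f t) p, cupProduct (show 2 * p + 2 * q = 2 * d by omega) ξ b = 0) → b = 0) :=
  nondegenerate_algebraicClasses_of_hodge (hf.isSmoothProjective_fiberOver t) hpq hp hq

/-- **(Perf_t) at every CM fibre under `HC_CM`** (a CM fibre is presented by a CM abelian variety, on which `HC_CM`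
makes all rational `(p,p)`-classes algebraic — the tree's `Ring2Transport.mem_algebraicClasses_of_cmChart`).
`HC_CM` is a BINDER. [cite: Andre1996Motifs, §6.3 a) (p. 33)] [cite: Kleiman1968AlgebraicCycles, §3] -/
theorem nondegenerate_algebraicClasses_fiberOver_of_HC_CM (hCM : RankFourFaces.CMAbelianHodge) {d : ℕ}
    {f : 𝒳 ⟶ S} (hf : IsCompactAbelianPencil f d) {t : ComplexPoints S} (ht : t ∈ cmLocus f d) {p q : ℕ}
    (hpq : p + q = d) :
    (∀ ξ ∈ algebraicClasses (fiberOver f t) p,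
        (∀ b ∈ algebraicClasses (fiberOver f t) q, cupProduct (show 2 * p + 2 * q = 2 * d by omega) ξ b = 0) → ξ = 0) ∧
      (∀ b ∈ algebraicClasses (fiberOver f t) q,
        (∀ ξ ∈ algebraicClasses (fiberOver f t) p, cupProduct (show 2 * p + 2 * q = 2 * d by omega) ξ b = 0) → b = 0) := by
  obtain ⟨A₀, ⟨e₀⟩, hdim, hcm⟩ := ht
  exact nondegenerate_algebraicClasses_fiberOver_of_hodge hf t hpq
    (fun c hc hcpp ↦ Ring2Transport.mem_algebraicClasses_of_cmChart hCM A₀ e₀ hdim hcm hc hcpp)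
    (fun c hc hcqq ↦ Ring2Transport.mem_algebraicClasses_of_cmChart hCM A₀ e₀ hdim hcm hc hcqq)

end Summit.HodgeConjecture.HodgeConjecture.Ring2.AbelianAll

end
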